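import Mathlib.Data.Real.Basic
import Mathlib.Algebra.Order.BigOperators.Group.Finset
import Mathlib.Algebra.BigOperators.Ring.Finset
import Mathlib.GroupTheory.Perm.Basic
import Mathlib.Data.Fintype.Perm
import Mathlib.Tactic
import HarnessLib

/-!
# Fixing holes, the shuffling lemma (Vassilevska Williams–Xu–Xu–Zhou 2024, Lemma 7.3) — proved

Topic `Literature/Computability/AlgebraicComplexity`.  §7 of Vassilevska Williams–Xu–Xu–Zhou,
*New bounds for matrix multiplication: from alpha to omega* (SODA 2024, arXiv:2307.07970) shows that
sub-polynomially many *broken* copies of a partitioned tensor `T` (copies in which a small fraction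
of the `X`-, `Y`-, `Z`-parts — the *holes* — is zeroed out) degenerate into an unbroken copy of `T`
(Thm. 7.2, whence Cor. 4.2 for interface tensors), provided `T` carries a family `𝒢` of symmetries
(Property 7.1): triples of permutations of the variables preserving the three partitions and the
tensor, such that a uniformly random element of `𝒢` moves any given part to a uniformly random part.
The probabilistic heart of the recursion is

> **Lemma 7.3.** Let `T` satisfy the assumptions of Thm. 7.2 with `𝒢`. Then there exists
> `(π_X, π_Y, π_Z) ∈ 𝒢` such that for any sets of parts `P_X, P'_X ⊆ 𝒫_X`, `P_Y, P'_Y ⊆ 𝒫_Y`,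
> `P_Z, P'_Z ⊆ 𝒫_Z` we have `|P_X ∩ π_X(P'_X)| ≤ 4 |P_X| |P'_X| / |𝒫_X|`, and likewise for `Y`, `Z`.

(Proof as printed: for uniformly random `(π_X,π_Y,π_Z) ∈ 𝒢`, `E |P_X ∩ π_X(P'_X)| = |P_X||P'_X|/|𝒫_X|`
by the uniformity in Property 7.1 and linearity of expectation; Markov's inequality makes each of the
three events "more than `4×` the mean" have probability `≤ 1/4` (indeed `< 1/4`), and a union bound
leaves an element of `𝒢` outside all three.)  The sets of parts are FIXED before the element of `𝒢`
is chosen — this is how the lemma is proved and how it is applied in the proof of Thm. 7.2 (to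
`P_X, P_X^{(0)}, …`); the printed sentence places "there exists `(π_X,π_Y,π_Z)`" before "for any sets
of parts", which read literally (`∃ ∀`) is false (take `P'_X = π_X⁻¹(P_X)` with `0 < |P_X| < |𝒫_X|/4`),
so the theorem below is the `∀ ∃` statement that is meant.

Only the permutations INDUCED on the sets of parts enter, so the lemma is stated for three families
of permutations of finite types `PX, PY, PZ` (the part index sets `𝒫_X, 𝒫_Y, 𝒫_Z`) indexed by a
nonempty finite type `Γ` (the family `𝒢`; different elements may induce the same permutations of
parts), with the uniformity of Property 7.1 (third item) as the counting hypothesis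
`#{γ | π_X^γ(t) = t'} · |𝒫_X| = |𝒢|` for all parts `t, t'`:

* `sum_card_inter_image_mul_card` — the expectation identity
  `(Σ_γ |P ∩ π^γ(P')|) · |𝒫| = |P| |P'| |𝒢|`;
* `four_mul_card_filter_lt_card` — Markov: fewer than `|𝒢|/4` elements have
  `|P ∩ π^γ(P')| · |𝒫| > 4 |P| |P'|`;
* `vxxz2024_lemma73` — the lemma (three coordinates, union bound), in the printed form with real
  quotients `4 |P| |P'| / |𝒫|`, and `vxxz2024_lemma73_mul` in cleared-denominator form.

Everything is proved; no definitions, no named facts.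

## References

* V. Vassilevska Williams, Y. Xu, Z. Xu, R. Zhou, *New bounds for matrix multiplication: from alpha
  to omega*, SODA 2024, arXiv:2307.07970, §7: Property 7.1, Thm. 7.2, Lemma 7.3 (and Cor. 4.2).
  [VassilevskaWilliamsXuXuZhou2024]
-/

open scoped BigOperators
open Finset

namespace Literature.Computability.AlgebraicComplexity

section OneCoordinate

variable {Γ α : Type*} [DecidableEq α]

/-- `P ∩ π(P')` is the image under `π` of `{t ∈ P' | π t ∈ P}`; in particular
`|P ∩ π(P')| = #{t ∈ P' | π t ∈ P}`. [folklore] -/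
theorem card_inter_image_perm (π : Equiv.Perm α) (P P' : Finset α) :
    (P ∩ P'.image π).card = (P'.filter fun t => π t ∈ P).card := by
  have h : P ∩ P'.image π = (P'.filter fun t => π t ∈ P).image π := by
    ext x
    simp only [mem_inter, mem_image, mem_filter]
    constructor
    · rintro ⟨hx, t, ht, rfl⟩
      exact ⟨t, ⟨ht, hx⟩, rfl⟩
    · rintro ⟨t, ⟨ht, hx⟩, rfl⟩
      exact ⟨hx, t, ht, rfl⟩
  rw [h, card_image_of_injective _ π.injective]

variable [Fintype Γ] [Fintype α]

/-- **Linearity of expectation under the uniformity of Property 7.1**: if for all parts `t, t'`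
exactly `|𝒢|/|𝒫|` elements `γ` of the family move `t` to `t'`, then
`(Σ_γ |P ∩ π^γ(P')|) · |𝒫| = |P| · |P'| · |𝒢|`, i.e. `E_γ |P ∩ π^γ(P')| = |P||P'|/|𝒫|`.
[cite: VassilevskaWilliamsXuXuZhou2024, Lemma 7.3 (proof)] -/
theorem sum_card_inter_image_mul_card (π : Γ → Equiv.Perm α)
    (hπ : ∀ t t' : α, (univ.filter fun γ => π γ t = t').card * Fintype.card α = Fintype.card Γ)
    (P P' : Finset α) :
    (∑ γ, (P ∩ P'.image (π γ)).card) * Fintype.card α = P.card * P'.card * Fintype.card Γ := by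
  classical
  -- `|P ∩ π(P')| = Σ_{t ∈ P'} Σ_{t'' ∈ P} [π t = t'']`
  have h1 : ∀ γ, (P ∩ P'.image (π γ)).card = ∑ t ∈ P', ∑ t'' ∈ P, if π γ t = t'' then 1 else 0 := by
    intro γ
    rw [card_inter_image_perm, card_filter]
    refine sum_congr rfl fun t _ => ?_
    rw [sum_ite_eq]
  simp_rw [h1]
  -- exchange the sums: `Σ_γ Σ_{t∈P'} Σ_{t''∈P} = Σ_{t∈P'} Σ_{t''∈P} Σ_γ`
  rw [sum_comm, sum_mul]
  have h2 : ∀ t ∈ P', (∑ γ, ∑ t'' ∈ P, if π γ t = t'' then 1 else 0) * Fintype.card α =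
      P.card * Fintype.card Γ := by
    intro t _
    rw [sum_comm, sum_mul]
    have h3 : ∀ t'' ∈ P, (∑ γ, if π γ t = t'' then 1 else 0) * Fintype.card α = Fintype.card Γ := by
      intro t'' _
      rw [← hπ t t'', card_filter]
    rw [sum_congr rfl h3, sum_const, smul_eq_mul]
  rw [sum_congr rfl h2, sum_const, smul_eq_mul]
  ring

/-- **Markov's inequality** for the count `|P ∩ π^γ(P')|`: under the uniformity hypothesis, fewer
than a quarter of the elements `γ` have `|P ∩ π^γ(P')| · |𝒫| > 4 |P| |P'|` (for a nonempty family).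
[cite: VassilevskaWilliamsXuXuZhou2024, Lemma 7.3 (proof)] -/
theorem four_mul_card_filter_lt_card [Nonempty Γ] (π : Γ → Equiv.Perm α)
    (hπ : ∀ t t' : α, (univ.filter fun γ => π γ t = t').card * Fintype.card α = Fintype.card Γ)
    (P P' : Finset α) :
    4 * (univ.filter fun γ => 4 * (P.card * P'.card) <
      (P ∩ P'.image (π γ)).card * Fintype.card α).card < Fintype.card Γ := by
  classical
  set B := univ.filter fun γ => 4 * (P.card * P'.card) < (P ∩ P'.image (π γ)).card * Fintype.card α
    with hB
  rcases B.eq_empty_or_nonempty with hBe | hBne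
  · rw [hBe, card_empty, mul_zero]
    exact Fintype.card_pos
  · -- `4|P||P'| · |B| < Σ_{γ ∈ B} |P ∩ π^γ P'| · |𝒫| ≤ Σ_γ … = |P||P'||𝒢|`
    have hlt : ∑ γ ∈ B, 4 * (P.card * P'.card) < ∑ γ ∈ B, (P ∩ P'.image (π γ)).card * Fintype.card α :=
      sum_lt_sum_of_nonempty hBne fun γ hγ => (mem_filter.1 hγ).2
    have hle : ∑ γ ∈ B, (P ∩ P'.image (π γ)).card * Fintype.card α ≤
        ∑ γ, (P ∩ P'.image (π γ)).card * Fintype.card α :=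
      sum_le_sum_of_subset_of_nonneg (subset_univ B) fun _ _ _ => Nat.zero_le _
    rw [sum_const, smul_eq_mul, ← sum_mul] at hlt
    rw [← sum_mul, ← sum_mul, sum_card_inter_image_mul_card π hπ P P'] at hle
    have h := hlt.trans_le hle
    -- `B.card * (4 |P||P'|) < |P||P'| |Γ|` forces `|P||P'| > 0`, then cancel
    have hpos : 0 < P.card * P'.card := by
      rcases Nat.eq_zero_or_pos (P.card * P'.card) with h0 | h0
      · rw [h0] at h; simp at h
      · exact h0
    have h' : (4 * B.card) * (P.card * P'.card) < Fintype.card Γ * (P.card * P'.card) := by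
      calc (4 * B.card) * (P.card * P'.card) = B.card * (4 * (P.card * P'.card)) := by ring
        _ < P.card * P'.card * Fintype.card Γ := h
        _ = Fintype.card Γ * (P.card * P'.card) := by ring
    exact Nat.lt_of_mul_lt_mul_right h'

end OneCoordinate

section Lemma73

/-- From `|A| · |𝒫| ≤ c` to `|A| ≤ c / |𝒫|` over `ℝ` (both sides vanish when `𝒫 = ∅`). [folklore] -/
private theorem card_le_div_of_mul_le {β : Type*} [Fintype β] (A : Finset β) {c : ℕ}
    (h : A.card * Fintype.card β ≤ c) : (A.card : ℝ) ≤ (c : ℝ) / Fintype.card β := by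
  rcases Nat.eq_zero_or_pos (Fintype.card β) with h0 | hpos
  · have hA : A.card = 0 := by
      rw [← Nat.le_zero, ← h0]
      exact card_le_univ A
    rw [hA, h0]
    simp
  · rw [le_div_iff₀ (by exact_mod_cast hpos)]
    exact_mod_cast h

variable {Γ PX PY PZ : Type*} [Fintype Γ] [Nonempty Γ] [Fintype PX] [Fintype PY] [Fintype PZ]
  [DecidableEq PX] [DecidableEq PY] [DecidableEq PZ]

/-- **VXXZ 2024, Lemma 7.3, cleared denominators.**  Let `(π_X^γ, π_Y^γ, π_Z^γ)_{γ ∈ 𝒢}` be a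
nonempty finite family of triples of permutations of the part sets `𝒫_X, 𝒫_Y, 𝒫_Z`, uniform in the
sense of Property 7.1 (for all parts `t, t'`, exactly `|𝒢|/|𝒫_X|` elements move `t` to `t'`, and
likewise for `Y`, `Z`).  Then for any sets of parts `P_X, P'_X, P_Y, P'_Y, P_Z, P'_Z` some element of
the family satisfies `|P_W ∩ π_W(P'_W)| · |𝒫_W| ≤ 4 |P_W| |P'_W|` for all three `W ∈ {X, Y, Z}`
simultaneously (Markov and a union bound over the three coordinates).
[cite: VassilevskaWilliamsXuXuZhou2024, Lemma 7.3] -/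
theorem vxxz2024_lemma73_mul (πX : Γ → Equiv.Perm PX) (πY : Γ → Equiv.Perm PY)
    (πZ : Γ → Equiv.Perm PZ)
    (hX : ∀ t t' : PX, (univ.filter fun γ => πX γ t = t').card * Fintype.card PX = Fintype.card Γ)
    (hY : ∀ t t' : PY, (univ.filter fun γ => πY γ t = t').card * Fintype.card PY = Fintype.card Γ)
    (hZ : ∀ t t' : PZ, (univ.filter fun γ => πZ γ t = t').card * Fintype.card PZ = Fintype.card Γ)
    (P P' : Finset PX) (Q Q' : Finset PY) (R R' : Finset PZ) :
    ∃ γ : Γ, (P ∩ P'.image (πX γ)).card * Fintype.card PX ≤ 4 * (P.card * P'.card) ∧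
      (Q ∩ Q'.image (πY γ)).card * Fintype.card PY ≤ 4 * (Q.card * Q'.card) ∧
      (R ∩ R'.image (πZ γ)).card * Fintype.card PZ ≤ 4 * (R.card * R'.card) := by
  classical
  set BX := univ.filter fun γ => 4 * (P.card * P'.card) < (P ∩ P'.image (πX γ)).card * Fintype.card PX
  set BY := univ.filter fun γ => 4 * (Q.card * Q'.card) < (Q ∩ Q'.image (πY γ)).card * Fintype.card PY
  set BZ := univ.filter fun γ => 4 * (R.card * R'.card) < (R ∩ R'.image (πZ γ)).card * Fintype.card PZ
  have hBX : 4 * BX.card < Fintype.card Γ := four_mul_card_filter_lt_card πX hX P P'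
  have hBY : 4 * BY.card < Fintype.card Γ := four_mul_card_filter_lt_card πY hY Q Q'
  have hBZ : 4 * BZ.card < Fintype.card Γ := four_mul_card_filter_lt_card πZ hZ R R'
  have hU : (BX ∪ BY ∪ BZ).card < Fintype.card Γ := by
    have h1 : (BX ∪ BY ∪ BZ).card ≤ BX.card + BY.card + BZ.card :=
      (card_union_le _ _).trans (Nat.add_le_add_right (card_union_le _ _) _)
    omega
  -- an element outside the three bad sets
  obtain ⟨γ, hγ⟩ : ∃ γ, γ ∉ BX ∪ BY ∪ BZ := by
    by_contra h
    have hall : ∀ γ, γ ∈ BX ∪ BY ∪ BZ := fun γ => by_contra fun hγ => h ⟨γ, hγ⟩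
    have : BX ∪ BY ∪ BZ = univ := eq_univ_iff_forall.2 hall
    rw [this, card_univ] at hU
    exact lt_irrefl _ hU
  simp only [mem_union, not_or] at hγ
  obtain ⟨⟨hγX, hγY⟩, hγZ⟩ := hγ
  refine ⟨γ, ?_, ?_, ?_⟩
  · simpa [BX] using hγX
  · simpa [BY] using hγY
  · simpa [BZ] using hγZ

/-- **VXXZ 2024, Lemma 7.3** (printed form, real quotients): under the uniformity of Property 7.1,
for any sets of parts `P_X, P'_X ⊆ 𝒫_X`, `P_Y, P'_Y ⊆ 𝒫_Y`, `P_Z, P'_Z ⊆ 𝒫_Z` there is an element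
`(π_X, π_Y, π_Z)` of the family with
`|P_X ∩ π_X(P'_X)| ≤ 4|P_X||P'_X|/|𝒫_X|`, `|P_Y ∩ π_Y(P'_Y)| ≤ 4|P_Y||P'_Y|/|𝒫_Y|`,
`|P_Z ∩ π_Z(P'_Z)| ≤ 4|P_Z||P'_Z|/|𝒫_Z|` (the sets of parts are fixed first; see the module
docstring on the order of quantifiers). [cite: VassilevskaWilliamsXuXuZhou2024, Lemma 7.3] -/
theorem vxxz2024_lemma73 (πX : Γ → Equiv.Perm PX) (πY : Γ → Equiv.Perm PY)
    (πZ : Γ → Equiv.Perm PZ)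
    (hX : ∀ t t' : PX, (univ.filter fun γ => πX γ t = t').card * Fintype.card PX = Fintype.card Γ)
    (hY : ∀ t t' : PY, (univ.filter fun γ => πY γ t = t').card * Fintype.card PY = Fintype.card Γ)
    (hZ : ∀ t t' : PZ, (univ.filter fun γ => πZ γ t = t').card * Fintype.card PZ = Fintype.card Γ)
    (P P' : Finset PX) (Q Q' : Finset PY) (R R' : Finset PZ) :
    ∃ γ : Γ, ((P ∩ P'.image (πX γ)).card : ℝ) ≤ 4 * (P.card * P'.card : ℝ) / Fintype.card PX ∧
      ((Q ∩ Q'.image (πY γ)).card : ℝ) ≤ 4 * (Q.card * Q'.card : ℝ) / Fintype.card PY ∧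
      ((R ∩ R'.image (πZ γ)).card : ℝ) ≤ 4 * (R.card * R'.card : ℝ) / Fintype.card PZ := by
  obtain ⟨γ, h1, h2, h3⟩ := vxxz2024_lemma73_mul πX πY πZ hX hY hZ P P' Q Q' R R'
  -- pass to real quotients; an empty part set forces both sides to vanish
  refine ⟨γ, ?_, ?_, ?_⟩
  · have := card_le_div_of_mul_le _ h1
    push_cast at this
    exact this
  · have := card_le_div_of_mul_le _ h2
    push_cast at this
    exact this
  · have := card_le_div_of_mul_le _ h3
    push_cast at this
    exact this

end Lemma73

end Literature.Computability.AlgebraicComplexity
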